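import Literature.Geometry.Lorentzian.ConformalCoordCurvature
import HarnessLib

/-!
# The scalar curvature of the conformal metric `u² · g` from its components:
# `S(u² G) = u⁻³ (S(G) u − 6 Δ_G u)` in dimension four (the conformal Laplacian)

Continuation of `ConformalCoordCurvature.lean` (namespace `MetricCoord`: components
`G : E → (E →L E →L ℝ)` of a pseudo-Riemannian metric, smooth, symmetric and nondegenerate on an
open set `V`, `IsMetricOn G V`; Christoffel map `chrAt`, scalar curvature `scalAt`, metric trace
`mtrAt`, coordinate Hessian `hessAt` and Laplace–Beltrami operator `lapAt = tr_G hessAt`). There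
the general law `IsMetricOn.scalAt_conformal` (Besse 1987, Thm. 1.159 (f):
`S' = c⁻¹ (S − 2(n−1) tr_G H − (n−2)(n−1) |θ|²)` for `G' = c · G`, `θ = dc/(2c)`, `H = ∇θ`) was
specialised to `c = ψ⁴` in dimension three (`scalAt_conformal_fourth_power`, the law behind the
Lichnerowicz equation). Here it is specialised to **`c = u²`**, the normalisation of
four-dimensional conformal geometry (`ĝ = u² g`; Gursky–LeBrun 1999, §3; Lee–Parker 1987, §1 with
`p − 2 = 4/(n−2) = 2` at `n = 4`):

* `confForm_sq` (`θ = du/u`), `IsMetricOn.fderiv_confForm_sq`, `IsMetricOn.confHess_sq`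
  (`H = Hess_G u/u − du ⊗ du/u²`);
* `IsMetricOn.scalAt_conformal_sq` — in any dimension `n = dim E`:
  **`S(u² G) = u⁻² (S(G) − 2(n−1) Δ_G u/u − (n−1)(n−4) |du|²_G/u²)`**, `|du|²_G = du(♯du)`;
* `IsMetricOn.scalAt_conformal_sq_four` — in dimension `n = 4` the gradient term drops out:
  **`S(u² G) = u⁻³ (S(G) u − 6 Δ_G u)`**, i.e. `S_{u²g} = u⁻³ L_g u` with the conformal Laplacian
  `L_g = −6Δ_g + S_g` of the analysts' sign convention `Δ_g = tr_g ∇d` (Lee–Parker 1987, (2.7):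
  `□ = 4((n−1)/(n−2))Δ + R` acting on `φ` with `g̃ = φ^{4/(n−2)} g`, `R̃ = φ^{−(n+2)/(n−2)} □φ` in
  their sign `Δ = −tr ∇d`; Gursky–LeBrun 1999, §3: "if `ĝ = u²g` […] then `𝔖_ĝ = u⁻³ ◇u`,
  `◇ = 6Δ_g + 𝔖_g`" with the positive Laplacian `Δ = d*d`, whose scalar-curvature part is the
  present identity).

Everything is proved; no statement of `Prop` type is introduced. Pure Fréchet calculus, valid for
components of any signature.

## References

* A. L. Besse, *Einstein manifolds*, Springer 1987, Thm. 1.159 (f). [Besse1987]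
* J. M. Lee, T. H. Parker, *The Yamabe problem*, Bull. AMS 17 (1987) 37–91, §1–§2, (2.7).
  [LeeParker1987]
* M. J. Gursky, C. LeBrun, *On Einstein manifolds of positive sectional curvature*, Ann. Global
  Anal. Geom. 17 (1999) 315–328 (arXiv:math/9807055), §3, proof of Lemma 4. [GurskyLebrun1999]
-/

noncomputable section

open Set Filter ContinuousLinearMap Module
open scoped Topology ContDiff

namespace Literature.Geometry.Lorentzian

namespace MetricCoord

variable {E : Type*} [NormedAddCommGroup E] [NormedSpace ℝ E]

section Square

variable [FiniteDimensional ℝ E] [CompleteSpace E] {G : E → E →L[ℝ] E →L[ℝ] ℝ} {u : E → ℝ}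
  {V : Set E} {x : E}

omit [FiniteDimensional ℝ E] [CompleteSpace E] in
/-- For `c = u²`: `θ = dc/(2c) = du/u`. [cite: Besse1987, Thm. 1.159] -/
theorem confForm_sq {y : E} (hu : DifferentiableAt ℝ u y) (hu0 : u y ≠ 0) :
    confForm (fun z ↦ u z ^ 2) y = (u y)⁻¹ • fderiv ℝ u y := by
  have h2 : fderiv ℝ (fun z ↦ u z ^ 2) y = ((2 : ℕ) • u y ^ (2 - 1)) • fderiv ℝ u y :=
    (hu.hasFDerivAt.pow 2).fderiv
  rw [confForm, h2, smul_smul]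
  congr 1
  rw [nsmul_eq_mul]
  field_simp
  ring

omit [FiniteDimensional ℝ E] [CompleteSpace E] in
/-- For `c = u²` the derivative of `θ = du/u` is `Dθ(x)(v)(w) = D²u(v,w)/u − ∂_v u ∂_w u/u²`.
[folklore] -/
theorem IsMetricOn.fderiv_confForm_sq (hG : IsMetricOn G V) (hu : ContDiffOn ℝ ∞ u V)
    (hu0 : ∀ y ∈ V, u y ≠ 0) (hx : x ∈ V) :
    fderiv ℝ (confForm (fun z ↦ u z ^ 2)) x =
      (u x)⁻¹ • fderiv ℝ (fderiv ℝ u) x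
        - (u x ^ 2)⁻¹ • (fderiv ℝ u x).smulRight (fderiv ℝ u x) := by
  have hux : ContDiffAt ℝ ∞ u x := hG.contDiffAt_of_contDiffOn hu hx
  have hd : HasFDerivAt u (fderiv ℝ u x) x := (hux.differentiableAt (by simp)).hasFDerivAt
  have heq : confForm (fun z ↦ u z ^ 2) =ᶠ[𝓝 x] fun y ↦ (u y)⁻¹ • fderiv ℝ u y :=
    (hG.eventually_mem hx).mono fun y hy ↦
      confForm_sq (hG.differentiableAt_of_contDiffOn hu hy) (hu0 y hy)
  have hinv : HasFDerivAt (fun y ↦ (u y)⁻¹) ((-(u x ^ 2)⁻¹) • fderiv ℝ u x) x :=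
    (hasDerivAt_inv (hu0 x hx)).comp_hasFDerivAt x hd
  have hD : HasFDerivAt (fderiv ℝ u) (fderiv ℝ (fderiv ℝ u) x) x :=
    ((hux.fderiv_right (m := ∞) (by simp)).differentiableAt (by simp)).hasFDerivAt
  have hθ' : HasFDerivAt (fun y ↦ (u y)⁻¹ • fderiv ℝ u y)
      ((u x)⁻¹ • fderiv ℝ (fderiv ℝ u) x
        + ((-(u x ^ 2)⁻¹) • fderiv ℝ u x).smulRight (fderiv ℝ u x)) x :=
    hinv.smul hD
  rw [heq.fderiv_eq, hθ'.fderiv]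
  ext v w
  simp only [_root_.add_apply, _root_.sub_apply, _root_.smul_apply, smul_eq_mul,
    ContinuousLinearMap.smulRight_apply, _root_.neg_apply, neg_smul]
  ring

omit [FiniteDimensional ℝ E] [CompleteSpace E] in
/-- For `c = u²`: the covariant Hessian of `f = log |u|` is `H = Hess_G u/u − du ⊗ du/u²`.
[folklore] -/
theorem IsMetricOn.confHess_sq (hG : IsMetricOn G V) (hu : ContDiffOn ℝ ∞ u V)
    (hu0 : ∀ y ∈ V, u y ≠ 0) (hx : x ∈ V) :
    confHess G (fun z ↦ u z ^ 2) x =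
      (u x)⁻¹ • hessAt G u x - (u x ^ 2)⁻¹ • (fderiv ℝ u x).smulRight (fderiv ℝ u x) := by
  ext v w
  rw [confHess_apply, hG.fderiv_confForm_sq hu hu0 hx,
    confForm_sq (hG.differentiableAt_of_contDiffOn hu hx) (hu0 x hx)]
  simp only [_root_.sub_apply, _root_.smul_apply, smul_eq_mul,
    ContinuousLinearMap.smulRight_apply, hessAt_apply]
  ring

/-- **The scalar curvature of `u² G` in any dimension `n = dim E`**:
`S(u² G) = u⁻² (S(G) − 2(n−1) Δ_G u / u − (n−1)(n−4) |du|²_G / u²)` with `Δ_G u = tr_G Hess_G u`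
(`lapAt`) and `|du|²_G = du(♯ du)`; from `scalAt_conformal` (Besse 1987, Thm. 1.159 (f)) with
`c = u²`, `θ = du/u`, `H = Hess u/u − du⊗du/u²`, `tr_G H = Δu/u − |du|²/u²`, `|θ|² = |du|²/u²`.
[cite: Besse1987, Thm. 1.159 (f)] -/
theorem IsMetricOn.scalAt_conformal_sq (hG : IsMetricOn G V) (hu : ContDiffOn ℝ ∞ u V)
    (hu0 : ∀ y ∈ V, u y ≠ 0) (hx : x ∈ V) :
    scalAt (fun y ↦ u y ^ 2 • G y) x =
      (u x ^ 2)⁻¹ * (scalAt G x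
        - 2 * (Module.finrank ℝ E - 1 : ℝ) * (u x)⁻¹ * lapAt G u x
        - (Module.finrank ℝ E - 1 : ℝ) * (Module.finrank ℝ E - 4 : ℝ) * (u x ^ 2)⁻¹ *
            fderiv ℝ u x (sharpAt G x (fderiv ℝ u x))) := by
  have hc : ContDiffOn ℝ ∞ (fun z ↦ u z ^ 2) V := hu.pow 2
  have hc0 : ∀ y ∈ V, u y ^ 2 ≠ 0 := fun y hy ↦ pow_ne_zero 2 (hu0 y hy)
  have hux := hu0 x hx
  rw [hG.scalAt_conformal hc hc0 hx, hG.confHess_sq hu hu0 hx, mtrAt_sub, mtrAt_smul,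
    mtrAt_smul, mtrAt_smulRight, confVec,
    confForm_sq (hG.differentiableAt_of_contDiffOn hu hx) hux, map_smul, map_smul,
    _root_.smul_apply, ← lapAt]
  simp only [smul_eq_mul]
  field_simp
  ring

/-- **The scalar curvature of `u² G` in dimension four: `S(u² G) = u⁻³ (S(G) u − 6 Δ_G u)`**
(the gradient terms cancel exactly when `n = 4`), i.e. `S_{u²g} u³ = L_g u` for the conformal
Laplacian `L_g = −6 Δ_g + S_g`, `Δ_g = tr_g ∇d` (Lee–Parker 1987, (2.7) at `n = 4`:
`R̃ = φ⁻³ (−6Δφ + Rφ)`-type law for `g̃ = φ² g`; the scalar-curvature part of Gursky–LeBrun 1999,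
§3, `𝔖_{u²g} = u⁻³ ◇u`, `◇ = 6Δ + 𝔖` with the positive Laplacian `Δ = d*d = −tr ∇d`).
[cite: LeeParker1987, (2.7)] [cite: GurskyLebrun1999, §3, proof of Lemma 4]
[cite: Besse1987, Thm. 1.159 (f)] -/
theorem IsMetricOn.scalAt_conformal_sq_four (hG : IsMetricOn G V) (hu : ContDiffOn ℝ ∞ u V)
    (hu0 : ∀ y ∈ V, u y ≠ 0) (hx : x ∈ V) (h4 : Module.finrank ℝ E = 4) :
    scalAt (fun y ↦ u y ^ 2 • G y) x = (u x ^ 3)⁻¹ * (scalAt G x * u x - 6 * lapAt G u x) := by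
  have hux := hu0 x hx
  rw [hG.scalAt_conformal_sq hu hu0 hx, h4]
  simp only [Nat.cast_ofNat]
  field_simp
  ring

end Square

end MetricCoord

end Literature.Geometry.Lorentzian

end
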